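import Literature.AlgebraicGeometry.HodgeTheory.MiddleDimensionReductionProofs
import Literature.AlgebraicGeometry.HodgeTheory.HodgeTypePullback
import Literature.AlgebraicGeometry.HodgeTheory.ComplexGysin
import Literature.AlgebraicGeometry.HodgeTheory.MotivatedClassesProofs
import Literature.AlgebraicGeometry.Motives.ComplexPointsOrientation
import HarnessLib

/-!
# Reduction of the Hodge conjecture to the middle dimension (BFNP Lemma 48) with the tree's REAL Gysin maps: the named fact modulo named facts and the Hodge compatibility of `complexGysin`

Family `hodge`, layer `Literature/AlgebraicGeometry/HodgeTheory`. Second companion of the named fact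
`middleDimensionReduction` (file `MiddleDimensionReduction`; P. Brosnan, H. Fang, Z. Nie,
G. Pearlstein, *Singularities of admissible normal functions*, Invent. Math. 177 (2009), §6
**Lemma 48**, arXiv:0711.0964 p. 13: "• The Hodge conjecture holds for all smooth projective complex
varieties `Y`. • For every smooth projective complex variety `X` of dimension `2n` with `n ∈ ℤ`,
`(Alg^n X)^⊥ = 0`" are equivalent; proof, case `dim Y < 2k`: "set `X = Y × ℙ^{2k − dim Y}` and let
`β = pr₁^* α` […] by the projection formula, `α ∪ pr_{1*}[Z] ≠ 0`"; case `dim Y > 2k`: Bertini and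
weak Lefschetz). The first companion `MiddleDimensionReductionProofs` proves the printed argument
RELATIVE TO A HYPOTHESIS STRUCTURE `G : GysinFormalism` (Gysin morphisms AND cycle classes with
eight printed properties, for which the tree deliberately has no existence fact) with its Hodge
compatibility `G.IsHodgeCompatible`, plus — for the Lefschetz-free upper half — the predicate
`PreservesHodgeType (n + 1) n pr₁`.

This file runs the same argument on the objects the tree actually HAS (library-first route), so
that every remaining hypothesis is either a NAMED FACT of the tree or a Hodge-theoretic property of
a REAL, constructed map:

* the covariant operation of the lower half is the tree's topological Gysin homomorphism
  `complexGysin μ hY hX f = gysinMap (μ hY) (μ hX) f(ℂ) = D_X⁻¹ ∘ f(ℂ)_* ∘ D_Y` (`HodgeTheory/ComplexGysin`,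
  `AlgebraicTopology/SingularHomology/GysinMap`; W. Fulton, *Young Tableaux*, App. B §B.1 (5)) relative
  to an orientation family `μ` (a `ℂ`-orientation of each closed `2n`-manifold `X(ℂ)`; orientations
  EXIST, `Motives.ComplexPoints.isOrientableOver`), whose functoriality `gysinMap_id`/`gysinMap_comp`
  is PROVED and whose compatibility with supports
  `gysinMap_mem_algebraicClasses_of_isSmoothProjective` (`f_!(Nᵖ H²ᵖ) ⊆ N^q H^{2q}`, Fulton App. B
  §B.2 Exercise 5 / Voisin II Prop. 9.21 (ii) on the coniveau carrier) is PROVED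
  (`HodgeTheory/MotivatedClassesProofs`); the Poincaré duality these need is a THEOREM for `X(ℂ)` of
  positive dimension (`Motives.ComplexPoints.bijective_poincareDualityMap_of_isSmoothProjective`,
  Hatcher Thm. 3.30), and dimension `0` only occurs in codimension `p = 0`, where every class is
  algebraic (`hodgeConjectureFor_codim_zero`) — so NO duality hypothesis remains;
* the Hodge compatibility of pull-backs needed by the upper half (`PreservesHodgeType (n + 1) n pr₁`
  for `X × ℙ¹ → X`, Voisin I §7.3.2) is the tree's `preservesHodgeType_of_nonempty_hodgeModel`
  (`HodgeTheory/HodgeTypePullback`) from the two named facts `hodgePQ_independent_of_hodgeModel`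
  (all Hodge models of `X` cut out the same `H^{p,q}`) and `nonempty_hodgeModel` (Serre GAGA + de
  Rham + Hodge decomposition); alternatively the upper half is hard Lefschetz, the named fact
  `nonempty_hardLefschetzNFold` (`HardLefschetzNFold.mem_algebraicClasses_of_lt_of_nonempty`,
  Kerr–Pearlstein 2011 §3.1, Thomas 2005 Prop. 2).

What is left as a hypothesis is exactly C. Voisin, *Hodge Theory and Complex Algebraic Geometry I*,
§7.3.2 for the real maps `complexGysin μ`: "the Gysin morphism `φ_*` […] is a morphism of Hodge
structures (of bidegree `(r, r)`)" — `hrat` (`f_*` preserves rational classes) and `htyp` (`f_*`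
maps type `(p, q)` to type `(p + r, q + r)`, `r = dim X − dim Y`), the two fields of
`GysinFormalism.IsGysinHodgeCompatible` read for `complexGysin μ` (they constrain `μ`: e.g. `hrat`
fails for `μ_Y` replaced by `i • μ_Y`; the intended `μ` is the complex orientation). Neither is a
theorem of the tree: both require the compatibility of a Hodge model's de Rham comparison with
Poincaré duality / cup products, cf. `CupPreservesHodgeType`.

## Results (all PROVED, no new named fact — D-0026)

* `mem_algebraicClasses_of_le_two_mul_of_nonempty_hodgeModel` — **the upper half `n ≤ 2p` from the
  two named facts** `hodgePQ_independent_of_hodgeModel`, `nonempty_hodgeModel` and the middle-degree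
  hypothesis (`ℙ¹`-steps of `MiddleDimensionReductionProofs`, no Gysin map, no Lefschetz theorem).
* `mem_algebraicClasses_of_two_mul_add_eq_of_complexGysin` — **the lower half `2p + r = n` with the
  real Gysin maps**: `c = pr_{1!} s_{t!} c` for the slice `s_t = (𝟙, t) : X → X × ℙʳ` at a complex
  point `t`, `s_{t!} c` a rational `(p + r, p + r)`-class in the middle degree of the `2(p+r)`-fold
  `X × ℙʳ` (by `hrat`, `htyp`), algebraic by hypothesis, and `pr_{1!}` maps `N^{p+r} H^{2(p+r)}` into
  `Nᵖ H²ᵖ` — the printed "`X = Y × ℙ^{2k − dim Y}` […] projection formula" read without the pairing.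
* `middleDimensionReduction_of_complexGysin` — **the named fact from `hrat`, `htyp` and the named
  facts `hodgePQ_independent_of_hodgeModel`, `nonempty_hodgeModel`**;
  `middleDimensionReduction_of_complexGysin_of_hardLefschetz` — the named fact from `hrat`, `htyp`
  and the named fact `nonempty_hardLefschetzNFold` (the tree's standard road for `2p > n`).

Hence the discharge `middleDimensionReduction_holds` is EXACTLY: the `_holds` theorems of
(`hodgePQ_independent_of_hodgeModel` and `nonempty_hodgeModel`) or of `nonempty_hardLefschetzNFold`,
plus Voisin I §7.3.2 for `complexGysin μ` of the complex orientation family. Any proof must produce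
Hodge models of auxiliary varieties (`IsOfHodgeType` on `X × ℙʳ` quantifies over
`HodgeModel _ (X ⊗ ℙʳ)`), i.e. needs `nonempty_hodgeModel` or its ingredients (de Rham's theorem on the
larger model space, the Hodge decomposition of the product); this file does not attempt them.

## References

* [BrosnanFangNiePearlstein2009] P. Brosnan, H. Fang, Z. Nie, G. Pearlstein, Singularities of
  admissible normal functions, Invent. Math. 177 (2009), §6 Lemma 48 (arXiv:0711.0964, p. 13).
* [VoisinHodgeI2002] C. Voisin, Hodge Theory and Complex Algebraic Geometry I, §7.3.2 (Gysin
  morphism, bidegree `(r, r)`), Thm. 6.25 / Rem. 6.27 (hard Lefschetz).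
* [VoisinHodgeII2003] C. Voisin, Hodge Theory and Complex Algebraic Geometry II, §9.2.4 Prop. 9.21 (ii).
* [FultonYoungTableaux1997] W. Fulton, Young Tableaux, Appendix B §B.1 (2), (5), §B.2 Exercise 5.
* [HatcherAT2002] A. Hatcher, Algebraic Topology, §3.3 Thm. 3.30.
* [KerrPearlstein2011] M. Kerr, G. Pearlstein, An exponential history of functions with logarithmic
  growth, MSRI Publ. 58 (2011), §3.1.  * [Thomas2005Nodes] R. Thomas, Nodes and the Hodge
  conjecture, J. Algebraic Geom. 14 (2005), Prop. 2.
-/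

noncomputable section

open CategoryTheory AlgebraicGeometry MonoidalCategory CartesianMonoidalCategory
open Literature.AlgebraicTopology.SingularHomology

namespace Literature.AlgebraicGeometry.HodgeTheory

section HodgeTheory

/-! ### The upper half from the two named facts -/

/-- **The Hodge conjecture in degrees `2p ≥ dim X` from the Hodge conjecture in the middle degree,
granted the named facts `hodgePQ_independent_of_hodgeModel` and `nonempty_hodgeModel`.** If every
rational middle-degree Hodge class on every even-dimensional smooth projective complex variety is
algebraic, then on a smooth projective `X` of dimension `n ≤ 2p` every rational `(p, p)`-class in
`H²ᵖ(X(ℂ); ℂ)` is algebraic: `2p − n` `ℙ¹`-steps `X ↦ X × ℙ¹`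
(`mem_algebraicClasses_of_le_two_mul_of_preservesHodgeType`: `c = s_t^*(pr₁^* c)` for a general
slice `s_t`, pull-backs of supports), the Hodge compatibility of `pr₁^* : H^*(X(ℂ)) → H^*((X × ℙ¹)(ℂ))`
(Voisin I §7.3.2) being the tree's `preservesHodgeType_of_nonempty_hodgeModel`. In print this half is
"suppose that `dim Y > 2k` […] Bertini […] weak Lefschetz"; no Lefschetz theorem and no Gysin map is
used here. [cite: BrosnanFangNiePearlstein2009, §6 Lemma 48 (proof, case dim Y > 2k)]
[cite: VoisinHodgeI2002, §7.3.2] -/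
theorem mem_algebraicClasses_of_le_two_mul_of_nonempty_hodgeModel
    (hI : hodgePQ_independent_of_hodgeModel)
    (hM : ∀ (m : ℕ) (Y : Motives.SchemeOver ℂ), nonempty_hodgeModel m Y)
    (hmid : ∀ ⦃m : ℕ⦄ ⦃Y : Motives.SchemeOver ℂ⦄, Motives.IsSmoothProjective (2 * m) Y →
      ∀ c : complexBetti Y (2 * m), IsRationalClass c → IsOfHodgeType (2 * m) Y (2 * m) m m c →
        c ∈ algebraicClasses Y m)
    {n : ℕ} {X : Motives.SchemeOver ℂ} (hX : Motives.IsSmoothProjective n X) {p : ℕ}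
    (hnp : n ≤ 2 * p) (c : complexBetti X (2 * p)) (hc : IsRationalClass c)
    (hpp : IsOfHodgeType n X (2 * p) p p c) : c ∈ algebraicClasses X p :=
  mem_algebraicClasses_of_le_two_mul_of_preservesHodgeType
    (fun m Y hY ↦ preservesHodgeType_of_nonempty_hodgeModel hI (hM (m + 1) (Y ⊗ Motives.projectiveSpace 1 ℂ))
      (Motives.IsSmoothProjective.tensor_holds hY (Motives.isSmoothProjective_projectiveSpace_holds ℂ 1))
      hY (fst Y (Motives.projectiveSpace 1 ℂ)))
    hmid hX hnp c hc hpp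

/-! ### The lower half with the real Gysin maps `complexGysin μ` -/

variable (μ : OrientationFamily)

/-- **The product half of BFNP Lemma 48 (degrees `2p ≤ n`) with the tree's real Gysin maps.** Let
`μ` be an orientation family (a `ℂ`-orientation of each `X(ℂ)`) whose Gysin morphisms
`complexGysin μ hY hX f = D_X⁻¹ ∘ f(ℂ)_* ∘ D_Y` preserve rational classes (`hrat`) and map classes of
type `(p, q)` to classes of type `(p + r, q + r)`, `r = dim X − dim Y` (`htyp`; Voisin I §7.3.2), and
suppose every rational middle-degree Hodge class on every even-dimensional smooth projective complex
variety is algebraic. Then for `X` smooth projective of dimension `n = 2p + r` every rational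
`(p, p)`-class `c ∈ H²ᵖ(X(ℂ); ℂ)` is algebraic: for a complex point `t` of `P = ℙʳ_ℂ` and the slice
`s = (𝟙, t) : X → X × P`, `s_! c` is a rational `(p + r, p + r)`-class in the middle degree of the
`2(p+r)`-fold `X × P`, hence algebraic, and `c = (pr₁ ∘ s)_! c = pr_{1!}(s_! c)` (`gysinMap_comp`,
`gysinMap_id`) lies in `pr_{1!}(N^{p+r} H^{2(p+r)}) ⊆ Nᵖ H²ᵖ(X(ℂ); ℂ)`
(`gysinMap_mem_algebraicClasses_of_isSmoothProjective`). Poincaré duality for `X(ℂ)` and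
`(X × P)(ℂ)` is the tree's theorem in positive dimension; `p = 0` (the only case allowing `n = 0`) is
`algebraicClasses X 0 = ⊤`. In print: "set `X = Y × ℙ^{2k − dim Y}` […] by the projection formula,
`α ∪ pr_{1*}[Z] ≠ 0`", read without the pairing.
[cite: BrosnanFangNiePearlstein2009, §6 Lemma 48 (proof, case dim Y < 2k)]
[cite: FultonYoungTableaux1997, Appendix B §B.1 (5) and §B.2 Exercise 5] [cite: VoisinHodgeI2002, §7.3.2] -/
theorem mem_algebraicClasses_of_two_mul_add_eq_of_complexGysin
    (hrat : ∀ ⦃m n : ℕ⦄ ⦃Y X : Motives.SchemeOver ℂ⦄ (hY : Motives.IsSmoothProjective m Y)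
      (hX : Motives.IsSmoothProjective n X) (f : Y ⟶ X) ⦃a b : ℕ⦄ (hab : a + 2 * n = b + 2 * m)
      ⦃y : complexBetti Y a⦄, IsRationalClass y → IsRationalClass (complexGysin μ hY hX f hab y))
    (htyp : ∀ ⦃m n : ℕ⦄ ⦃Y X : Motives.SchemeOver ℂ⦄ (hY : Motives.IsSmoothProjective m Y)
      (hX : Motives.IsSmoothProjective n X) (f : Y ⟶ X) ⦃a b : ℕ⦄ (hab : a + 2 * n = b + 2 * m)
      ⦃p q p' q' : ℕ⦄, p' + m = p + n → q' + m = q + n → ∀ ⦃y : complexBetti Y a⦄,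
      IsOfHodgeType m Y a p q y → IsOfHodgeType n X b p' q' (complexGysin μ hY hX f hab y))
    (hmid : ∀ ⦃m : ℕ⦄ ⦃Y : Motives.SchemeOver ℂ⦄, Motives.IsSmoothProjective (2 * m) Y →
      ∀ c : complexBetti Y (2 * m), IsRationalClass c → IsOfHodgeType (2 * m) Y (2 * m) m m c →
        c ∈ algebraicClasses Y m)
    {n : ℕ} {X : Motives.SchemeOver ℂ} (hX : Motives.IsSmoothProjective n X) {p r : ℕ}
    (hr : 2 * p + r = n) (c : complexBetti X (2 * p)) (hc : IsRationalClass c)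
    (hpp : IsOfHodgeType n X (2 * p) p p c) : c ∈ algebraicClasses X p := by
  -- codimension `0`: every class is algebraic (and this is the only case with `n = 0`)
  rcases Nat.eq_zero_or_pos p with rfl | hp
  · exact hodgeConjectureFor_codim_zero c
  -- the auxiliary factor `P = ℙʳ_ℂ`, a complex point `t` of it, and the smooth projective `X × P`
  have hP : Motives.IsSmoothProjective r (Motives.projectiveSpace r ℂ) :=
    Motives.isSmoothProjective_projectiveSpace_holds ℂ r
  haveI := connectedSpace_complexPoints hP
  obtain ⟨t⟩ : Nonempty (Motives.ComplexPoints (Motives.projectiveSpace r ℂ)) := inferInstance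
  have hXP : Motives.IsSmoothProjective (n + r) (X ⊗ Motives.projectiveSpace r ℂ) :=
    Motives.IsSmoothProjective.tensor_holds hX hP
  -- Poincaré duality for the closed manifolds `X(ℂ)` and `(X × P)(ℂ)` of positive dimension
  have hDX : (μ hX).HasPoincareDuality := fun a q h ↦
    Motives.ComplexPoints.bijective_poincareDualityMap_of_isSmoothProjective hX (by omega) (μ hX) h
  have hDXP : (μ hXP).HasPoincareDuality := fun a q h ↦
    Motives.ComplexPoints.bijective_poincareDualityMap_of_isSmoothProjective hXP (by omega) (μ hXP) h
  -- `c' = s_! c` for the slice `s = (𝟙, t) : X ⟶ X × P`: a middle-degree rational Hodge class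
  obtain ⟨c', hc'def⟩ : ∃ c' : complexBetti (X ⊗ Motives.projectiveSpace r ℂ) (2 * (p + r)),
      complexGysin μ hX hXP (Motives.sliceAt X t)
        (show 2 * p + 2 * (n + r) = 2 * (p + r) + 2 * n by ring) c = c' :=
    ⟨_, rfl⟩
  have hc'rat : IsRationalClass c' := by
    rw [← hc'def]
    exact hrat hX hXP _ _ hc
  have hc'typ : IsOfHodgeType (n + r) (X ⊗ Motives.projectiveSpace r ℂ) (2 * (p + r)) (p + r) (p + r)
      c' := by
    rw [← hc'def]
    exact htyp hX hXP _ _ (by omega) (by omega) hpp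
  -- `X × P` has the even dimension `n + r = 2 (p + r)`: `c'` is algebraic by hypothesis
  have hdim : n + r = 2 * (p + r) := by omega
  have hXP' : Motives.IsSmoothProjective (2 * (p + r)) (X ⊗ Motives.projectiveSpace r ℂ) := hdim ▸ hXP
  rw [hdim] at hc'typ
  have halg := hmid hXP' c' hc'rat hc'typ
  -- `c = (s ≫ pr₁)_! c = pr₁_! (s_! c)`
  have hcc : gysinMap (μ hXP) (μ hX)
      (Motives.AlgPoints.mapContinuous (L := ℂ) (fst X (Motives.projectiveSpace r ℂ)))
      (show 2 * (p + r) + (2 * n - 2 * p) = 2 * (n + r) by omega)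
      (show 2 * p + (2 * n - 2 * p) = 2 * n by omega) c' = c := by
    rw [← hc'def, complexGysin_eq_gysinMap hX hXP (Motives.sliceAt X t) _ (q := 2 * n - 2 * p)
        (by omega) (by omega),
      ← LinearMap.comp_apply, ← gysinMap_comp hDXP, ← Motives.AlgPoints.mapContinuous_comp,
      Motives.sliceAt_fst, Motives.AlgPoints.mapContinuous_id, gysinMap_id hDX, LinearMap.id_apply]
  -- `pr₁_!` maps `N^{p+r} H^{2(p+r)}((X × P)(ℂ))` into `Nᵖ H²ᵖ(X(ℂ))`
  rw [← hcc]
  exact gysinMap_mem_algebraicClasses_of_isSmoothProjective hXP hX (μ hXP) (μ hX) hDX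
    (fst X (Motives.projectiveSpace r ℂ)) _ _ (by omega) halg

/-! ### The named fact modulo named facts and the Hodge compatibility of `complexGysin μ` -/

/-- **BFNP Lemma 48 from the Hodge compatibility of the real Gysin maps and the named facts
`hodgePQ_independent_of_hodgeModel`, `nonempty_hodgeModel`.** If for some orientation family `μ`
the Gysin morphisms `complexGysin μ` preserve rational classes and have bidegree `(r, r)` (Voisin I
§7.3.2), and the two named facts hold, then `middleDimensionReduction` holds: degrees `2p ≤ n` by
`mem_algebraicClasses_of_two_mul_add_eq_of_complexGysin` (`c = pr_{1!} s_! c` on `X × ℙ^{n−2p}`),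
degrees `2p > n` by `mem_algebraicClasses_of_le_two_mul_of_nonempty_hodgeModel` (`ℙ¹`-steps). No
hypothesis structure, no Lefschetz theorem, no pairing. [cite: BrosnanFangNiePearlstein2009, §6 Lemma 48]
[cite: VoisinHodgeI2002, §7.3.2] -/
theorem middleDimensionReduction_of_complexGysin
    (hrat : ∀ ⦃m n : ℕ⦄ ⦃Y X : Motives.SchemeOver ℂ⦄ (hY : Motives.IsSmoothProjective m Y)
      (hX : Motives.IsSmoothProjective n X) (f : Y ⟶ X) ⦃a b : ℕ⦄ (hab : a + 2 * n = b + 2 * m)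
      ⦃y : complexBetti Y a⦄, IsRationalClass y → IsRationalClass (complexGysin μ hY hX f hab y))
    (htyp : ∀ ⦃m n : ℕ⦄ ⦃Y X : Motives.SchemeOver ℂ⦄ (hY : Motives.IsSmoothProjective m Y)
      (hX : Motives.IsSmoothProjective n X) (f : Y ⟶ X) ⦃a b : ℕ⦄ (hab : a + 2 * n = b + 2 * m)
      ⦃p q p' q' : ℕ⦄, p' + m = p + n → q' + m = q + n → ∀ ⦃y : complexBetti Y a⦄,
      IsOfHodgeType m Y a p q y → IsOfHodgeType n X b p' q' (complexGysin μ hY hX f hab y))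
    (hI : hodgePQ_independent_of_hodgeModel)
    (hM : ∀ (m : ℕ) (Y : Motives.SchemeOver ℂ), nonempty_hodgeModel m Y) :
    middleDimensionReduction := by
  intro hmid n X hX p c hc hpp
  rcases Nat.lt_or_ge n (2 * p) with hlt | hle
  · exact mem_algebraicClasses_of_le_two_mul_of_nonempty_hodgeModel hI hM hmid hX hlt.le c hc hpp
  · exact mem_algebraicClasses_of_two_mul_add_eq_of_complexGysin μ hrat htyp hmid hX
      (r := n - 2 * p) (by omega) c hc hpp

/-- **BFNP Lemma 48 from the Hodge compatibility of the real Gysin maps and hard Lefschetz** (the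
named fact `nonempty_hardLefschetzNFold`, Voisin I Thm. 6.25 / Rem. 6.27; the road of
Kerr–Pearlstein 2011 §3.1 and Thomas 2005 Prop. 2 for `2p > n`): degrees `2p ≤ n` by
`mem_algebraicClasses_of_two_mul_add_eq_of_complexGysin`, degrees `2p > n` by
`mem_algebraicClasses_of_lt_of_nonempty` (`c = L^{2p−n} c'` with `c'` a rational
`(n − p, n − p)`-class of degree `2(n − p) < n`, algebraic by the product half). No Hodge model of an
auxiliary variety enters except through `htyp`. [cite: BrosnanFangNiePearlstein2009, §6 Lemma 48]
[cite: KerrPearlstein2011, §3.1] [cite: VoisinHodgeI2002, Thm. 6.25, Rem. 6.27 and §7.3.2] -/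
theorem middleDimensionReduction_of_complexGysin_of_hardLefschetz
    (hrat : ∀ ⦃m n : ℕ⦄ ⦃Y X : Motives.SchemeOver ℂ⦄ (hY : Motives.IsSmoothProjective m Y)
      (hX : Motives.IsSmoothProjective n X) (f : Y ⟶ X) ⦃a b : ℕ⦄ (hab : a + 2 * n = b + 2 * m)
      ⦃y : complexBetti Y a⦄, IsRationalClass y → IsRationalClass (complexGysin μ hY hX f hab y))
    (htyp : ∀ ⦃m n : ℕ⦄ ⦃Y X : Motives.SchemeOver ℂ⦄ (hY : Motives.IsSmoothProjective m Y)
      (hX : Motives.IsSmoothProjective n X) (f : Y ⟶ X) ⦃a b : ℕ⦄ (hab : a + 2 * n = b + 2 * m)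
      ⦃p q p' q' : ℕ⦄, p' + m = p + n → q' + m = q + n → ∀ ⦃y : complexBetti Y a⦄,
      IsOfHodgeType m Y a p q y → IsOfHodgeType n X b p' q' (complexGysin μ hY hX f hab y))
    (hHL : ∀ (n : ℕ) (X : Motives.SchemeOver ℂ), nonempty_hardLefschetzNFold n X) :
    middleDimensionReduction := by
  intro hmid n X hX p c hc hpp
  rcases Nat.lt_or_ge n (2 * p) with hlt | hle
  · exact mem_algebraicClasses_of_lt_of_nonempty (hHL n X) hX hlt
      (fun c' hc' hpp' ↦ mem_algebraicClasses_of_two_mul_add_eq_of_complexGysin μ hrat htyp hmid hX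
        (r := n - 2 * (n - p)) (by omega) c' hc' hpp') c hc hpp
  · exact mem_algebraicClasses_of_two_mul_add_eq_of_complexGysin μ hrat htyp hmid hX
      (r := n - 2 * p) (by omega) c hc hpp

end HodgeTheory

end Literature.AlgebraicGeometry.HodgeTheory

end
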